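import Literature.Geometry.Riemannian.CoerciveSchrodingerClosed
import Literature.Geometry.Lorentzian.GreenIdentityCompactSupport
import Literature.Geometry.Lorentzian.MassCapacityHarmonic
import HarnessLib

/-!
# Interior regularity of weak solutions of `Δ_h u − f u = g` on an open set

Localisation of the regularity theory of `WeakSolutionRegularity.lean` /
`CoerciveSchrodingerClosed.lean` (Folland 1995, Cor. (6.34) — the tree's theorem
`Folland1995_cor634_holds`; Gilbarg–Trudinger, Cor. 8.11) to an OPEN SET `U ⊆ N`: the weak
identity `∫ u (Δ_h ζ − f ζ) dμ_h = ∫ g ζ dμ_h` is assumed only for `ζ ∈ C_c^∞(N)` with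
`tsupport ζ ⊆ U`, and the conclusions hold on `U`. This is the form needed by the weak Dirichlet
problem on balls (`DirichletProblemWeak.lean`), whose solution is weakly harmonic in the ball only.

* `integral_comp_extChartAt_symm_divForm_of_weakAt` — the chart-level divergence-form identity
  for ONE test function (same proof as `integral_comp_extChartAt_symm_divForm_of_veryWeak_smooth`,
  the weak identity assumed only for the zero extension of `ψ ∘ φ`);
* `exists_contMDiffOn_ae_eq_of_veryWeakOn_smooth` — every `x ∈ U` has a neighbourhood `V ⊆ U` on
  which `u` agrees a.e. with a `C^∞` function (Euclidean regularity in the chart at `x`, on the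
  open subset of the chart target corresponding to `U`);
* `exists_contMDiffOn_ae_eq_on_of_forall_exists_nhds`,
  `exists_contMDiffOn_ae_eq_on_of_veryWeakOn_smooth` — a representative `C^∞` on all of `U`;
* `dalembertian_sub_mul_eq_on_of_veryWeakOn` — a function `C^∞` on `U` weakly solving the
  equation in `U` solves it classically on `U` (cut-off globalisation, Green's identity twice,
  locality of `Δ_h`, the local fundamental lemma
  `IsOpen.ae_eq_zero_of_integral_contMDiff_smul_eq_zero`, continuity);
* `exists_contMDiffOn_harmonic_ae_eq_of_weaklyHarmonicOn` — **interior regularity of weakly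
  harmonic functions on `U`**: a locally integrable `u` with `∫ u Δ_h ζ = 0` for all
  `ζ ∈ C_c^∞(N)`, `tsupport ζ ⊆ U`, agrees a.e. on `U` with a function `v`, `C^∞` on `U`, with
  `Δ_h v = 0` on `U` (Weyl's lemma on manifolds, local form).

No definitions, no named facts (D-0026). Groundwork for `CheegerColding1997_sphereStability`
(block (II): harmonic replacements on balls).

## References

* G. B. Folland, *Introduction to PDE*, 2nd ed. (1995), Cor. (6.34). [Folland2020]
* D. Gilbarg, N. Trudinger, *Elliptic PDE of second order*, Cor. 8.11. [GilbargTrudinger2001]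
* I. Chavel, *Riemannian geometry, a modern introduction*, 2nd ed. (2006), §III.7. [Chavel2006]
-/

noncomputable section

open Bundle Set Function Filter Manifold MeasureTheory Measure TopologicalSpace Finset
open scoped Manifold ContDiff Topology Matrix ENNReal

namespace Literature.Geometry.Lorentzian

open PseudoRiemannianMetric

/-! ### §1 The chart identity for one test function -/

section ChartIdentity

variable {m : ℕ} {H : Type*} [TopologicalSpace H]
  {I : ModelWithCorners ℝ (EuclideanSpace ℝ (Fin m)) H} [I.Boundaryless]
  {N : Type*} [TopologicalSpace N] [ChartedSpace H N] [IsManifold I ∞ N]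
  [T2Space N] [LocallyCompactSpace N] [MeasurableSpace N] [BorelSpace N]
  (h : ContMDiffRiemannianMetric I ∞ (EuclideanSpace ℝ (Fin m)) (TangentSpace I : N → Type _))
  [(ofRiemannian h).HasLeviCivita]

/-- **The distributional equation read in a chart, one test function**: same statement and proof
as `integral_comp_extChartAt_symm_divForm_of_veryWeak_smooth` (Chavel 2006, §III.3 (III.3.6),
§III.7), with the weak identity assumed only for the zero extension `ζ` of `ψ ∘ φ`.
[cite: Chavel2006, §III.3 (III.3.6)] -/
theorem integral_comp_extChartAt_symm_divForm_of_weakAt (x : N) {u : N → ℝ}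
    (hum : Measurable u) {f g : N → ℝ} (hf : Continuous f) (hg : Continuous g)
    {ψ : EuclideanSpace ℝ (Fin m) → ℝ} (hψ : ContDiff ℝ ∞ ψ) (hψc : HasCompactSupport ψ)
    (hψT : tsupport ψ ⊆ (extChartAt I x).target)
    (hWζ : ∫ p, u p * ((ofRiemannian h).dalembertian
        ((chartAt H x).source.indicator (ψ ∘ extChartAt I x)) p -
          f p * (chartAt H x).source.indicator (ψ ∘ extChartAt I x) p) ∂riemannianMeasure h =
      ∫ p, g p * (chartAt H x).source.indicator (ψ ∘ extChartAt I x) p ∂riemannianMeasure h) :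
    ∫ y, u ((extChartAt I x).symm y) *
        ((∑ i, ∑ j, fderiv ℝ (fun z ↦ (Real.sqrt (chartGramMatrix h x z).det *
            (chartGramMatrix h x z)⁻¹ j i) *
            fderiv ℝ ψ z ((EuclideanSpace.basisFun (Fin m) ℝ).toBasis i)) y
            ((EuclideanSpace.basisFun (Fin m) ℝ).toBasis j)) -
          (Real.sqrt (chartGramMatrix h x y).det * f ((extChartAt I x).symm y)) * ψ y) =
      ∫ y, (Real.sqrt (chartGramMatrix h x y).det * g ((extChartAt I x).symm y)) * ψ y := by
  classical
  -- notation: the standard basis, the chart target, the Gram matrix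
  set b : Module.Basis (Fin m) ℝ (EuclideanSpace ℝ (Fin m)) := (EuclideanSpace.basisFun (Fin m) ℝ).toBasis
    with hb_def
  obtain ⟨T, hTdef⟩ : ∃ T : Set (EuclideanSpace ℝ (Fin m)), T = (extChartAt I x).target := ⟨_, rfl⟩
  have hT : IsOpen T := by rw [hTdef]; exact isOpen_extChartAt_target x
  have hTm : MeasurableSet T := hT.measurableSet
  have hsrc : (chartAt H x).source = (extChartAt I x).source :=
    (extChartAt_source (I := I) (x := x)).symm
  have hψT' : tsupport ψ ⊆ T := hTdef ▸ hψT
  obtain ⟨Gh, hGh⟩ : ∃ Gh : EuclideanSpace ℝ (Fin m) → Fin m → Fin m → ℝ,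
      Gh = fun y i j ↦ chartGramMatrix h x y i j := ⟨_, rfl⟩
  have hofG : ∀ y, Matrix.of (Gh y) = chartGramMatrix h x y := fun y ↦ by
    rw [hGh]; rfl
  -- the zero extension `ζ` of `ψ ∘ φ`
  obtain ⟨ζ, hζdef⟩ : ∃ ζ : N → ℝ, ζ = (chartAt H x).source.indicator (ψ ∘ extChartAt I x) :=
    ⟨_, rfl⟩
  have hψ2 : ContDiff ℝ 2 ψ := by exact_mod_cast contDiff_infty.1 hψ 2
  have hζs' : CMDiff ∞ ζ := by
    rw [hζdef]
    exact contMDiff_indicator_comp_extChartAt x hψ hψc hψT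
  have hζs : CMDiff 2 ζ := hζs'.of_le (WithTop.coe_le_coe.mpr le_top)
  have hζc : HasCompactSupport ζ := by
    rw [hζdef]; exact hasCompactSupport_indicator_comp_extChartAt x hψc hψT
  obtain ⟨hts, -, hKS⟩ := tsupport_indicator_comp_extChartAt_subset (I := I) x hψc hψT
  have hζsupp : tsupport ζ ⊆ (extChartAt I x).source := by
    rw [hζdef, ← hsrc]; exact hts.trans hKS
  have hζT : ∀ y ∈ T, ζ ((extChartAt I x).symm y) = ψ y := fun y hy ↦ by
    rw [hζdef]; exact indicator_comp_extChartAt_symm_apply x ψ (hTdef ▸ hy)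
  -- the weak identity for `ζ`
  have hW : ∫ p, u p * ((ofRiemannian h).dalembertian ζ p - f p * ζ p) ∂riemannianMeasure h =
      ∫ p, g p * ζ p ∂riemannianMeasure h := by rw [hζdef]; exact hWζ
  -- regularity of the metric data on `T`
  have hGT : ∀ y ∈ T, ∀ i j, Gh y i j = (ofRiemannian h).val ((extChartAt I x).symm y)
      ((trivializationAt (EuclideanSpace ℝ (Fin m)) (TangentSpace I) x).localFrame b i
        ((extChartAt I x).symm y))
      ((trivializationAt (EuclideanSpace ℝ (Fin m)) (TangentSpace I) x).localFrame b j
        ((extChartAt I x).symm y)) := by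
    intro y hy i j
    rw [hGh]
    exact chartGramMatrix_apply_eq_val_localFrame h x (hTdef ▸ hy) i j
  have hGsm : ∀ i j, ContDiffOn ℝ ∞ (fun y ↦ Gh y i j) T := fun i j ↦ by
    rw [hTdef]
    exact (contDiffOn_gram_comp_extChartAt_symm b (ofRiemannian h) i j).congr
      (fun y hy ↦ hGT y (hTdef ▸ hy) i j)
  have hGpi : ContDiffOn ℝ ∞ Gh T :=
    contDiffOn_pi.2 fun i ↦ contDiffOn_pi.2 fun j ↦ hGsm i j
  have hGsym : ∀ z i j, Gh z i j = Gh z j i := fun z i j ↦ by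
    rw [hGh]; exact chartGramMatrix_apply_comm h x z i j
  have hdetpos : ∀ y ∈ T, 0 < (Matrix.of (Gh y)).det := fun y hy ↦ by
    rw [hofG]
    exact Real.sqrt_pos.1 (sqrt_det_chartGramMatrix_pos h x (hTdef ▸ hy))
  have hGdet : ContDiffOn ℝ ∞ (fun y ↦ (Matrix.of (Gh y)).det) T := by
    intro y hy
    have h1 := contMDiffAt_matrix_det (I := 𝓘(ℝ, EuclideanSpace ℝ (Fin m))) (k := ∞)
      (A := fun y ↦ Matrix.of (Gh y)) (x₀ := y)
      (fun i j ↦ contMDiffAt_iff_contDiffAt.2 ((hGsm i j).contDiffAt (hT.mem_nhds hy)))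
    exact (contMDiffAt_iff_contDiffAt.1 h1).contDiffWithinAt
  have hρ : ContDiffOn ℝ ∞ (fun y ↦ Real.sqrt (Matrix.of (Gh y)).det) T :=
    hGdet.sqrt fun y hy ↦ (hdetpos y hy).ne'
  have hGinv : ∀ i l, ContDiffOn ℝ ∞ (fun y ↦ (Matrix.of (Gh y))⁻¹ i l) T := by
    intro i l y hy
    have h1 := contMDiffAt_matrix_inv (I := 𝓘(ℝ, EuclideanSpace ℝ (Fin m))) (k := ∞)
      (A := fun y ↦ Matrix.of (Gh y)) (x₀ := y)
      (fun i j ↦ contMDiffAt_iff_contDiffAt.2 ((hGsm i j).contDiffAt (hT.mem_nhds hy)))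
      (hdetpos y hy).ne' i l
    exact (contMDiffAt_iff_contDiffAt.1 h1).contDiffWithinAt
  -- the coefficients `a i j = √g G⁻¹ j i` and the fluxes `W j = ∑ᵢ a i j ∂ᵢψ`
  obtain ⟨a, ha⟩ : ∃ a : Fin m → Fin m → EuclideanSpace ℝ (Fin m) → ℝ,
      a = fun i j z ↦ Real.sqrt (Matrix.of (Gh z)).det * (Matrix.of (Gh z))⁻¹ j i := ⟨_, rfl⟩
  have haT : ∀ i j, ContDiffOn ℝ ∞ (a i j) T := fun i j ↦ by
    rw [ha]; exact hρ.mul (hGinv j i)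
  obtain ⟨W, hWdef⟩ : ∃ W : Fin m → EuclideanSpace ℝ (Fin m) → ℝ, W = fun i y ↦
      Real.sqrt (Matrix.of (Gh y)).det * ∑ l, (Matrix.of (Gh y))⁻¹ i l * fderiv ℝ ψ y (b l) :=
    ⟨_, rfl⟩
  have hWa : ∀ j, W j = fun z ↦ ∑ i, a i j z * fderiv ℝ ψ z (b i) := by
    intro j
    rw [hWdef, ha]
    funext z
    dsimp only
    rw [Finset.mul_sum]
    refine Finset.sum_congr rfl fun i _ ↦ ?_
    ring
  have hdψ : ∀ l, ContDiff ℝ ∞ (fun y ↦ fderiv ℝ ψ y (b l)) := fun l ↦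
    (hψ.fderiv_right (m := ∞) (by exact_mod_cast le_top)).clm_apply contDiff_const
  have hmemS : ∀ y ∈ T, (extChartAt I x).symm y ∈ (chartAt H x).source := fun y hy ↦ by
    rw [hsrc]; exact (extChartAt I x).map_target (hTdef ▸ hy)
  have hright : ∀ y ∈ T, extChartAt I x ((extChartAt I x).symm y) = y := fun y hy ↦
    (extChartAt I x).right_inv (hTdef ▸ hy)
  have hTnhds : ∀ y ∈ T, T ∈ 𝓝 y := fun y hy ↦ hT.mem_nhds hy
  -- (1) the Laplacian of `ζ` in the chart, in divergence form: `√g Δζ ∘ φ⁻¹ = ∑ᵢ ∂ᵢ Wᵢ` on `T`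
  have hΔ : ∀ y ∈ T, Real.sqrt (Matrix.of (Gh y)).det *
      (ofRiemannian h).dalembertian ζ ((extChartAt I x).symm y) = ∑ i, fderiv ℝ (W i) y (b i) := by
    intro y hy
    have hGy : HasFDerivAt Gh (fderiv ℝ Gh y) y :=
      ((hGpi.contDiffAt (hTnhds y hy)).differentiableAt (by simp)).hasFDerivAt
    have hf2y : HasFDerivAt (fun z ↦ fderiv ℝ ψ z) (fderiv ℝ (fderiv ℝ ψ) y) y :=
      (((hψ2.fderiv_right (m := 1) (by norm_num)).contDiffAt).differentiableAt
        one_ne_zero).hasFDerivAt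
    have hL := dalembertian_eq_sum_localFrame (ofRiemannian h) b (hmemS y hy)
      (hζs ((extChartAt I x).symm y)) (Gh := Gh) (fh := ψ) (by
        rw [hright y hy]
        filter_upwards [hTnhds y hy] with z hz
        exact hGT z hz) (by
        rw [hright y hy]
        filter_upwards [hTnhds y hy] with z hz
        rw [Function.comp_apply, hζT z hz])
    rw [hright y hy] at hL
    have hC := Literature.Analysis.Calculus.coordLaplacian_mul_sqrt_det_eq_sum_fderiv b hGy hGsym
      (hdetpos y hy) hf2y
    rw [hL]
    simp only [Literature.Analysis.Calculus.fderiv_apply_apply_eq hGy] at hC ⊢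
    rw [hC, hWdef]
  -- (2) `∑ⱼ ∂ⱼ Wⱼ = ∑ᵢⱼ ∂ⱼ(a i j ∂ᵢψ)` on `T`
  have hdiv : ∀ y ∈ T, ∑ j, fderiv ℝ (W j) y (b j) =
      ∑ i, ∑ j, fderiv ℝ (fun z ↦ a i j z * fderiv ℝ ψ z (b i)) y (b j) := by
    intro y hy
    rw [Finset.sum_comm]
    refine Finset.sum_congr rfl fun j _ ↦ ?_
    rw [hWa j, fderiv_fun_sum fun i _ ↦ ?_]
    · simp only [FunLike.coe_sum, Finset.sum_apply]
    · exact (((haT i j).contDiffAt (hTnhds y hy)).differentiableAt (by simp)).mul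
        ((hdψ i).differentiable (by simp) y)
  -- (3) the left-hand side in the chart
  haveI : IsFiniteMeasureOnCompacts (riemannianMeasure h) :=
    ⟨fun K hK ↦ riemannianVolume_lt_top_of_isCompact_holds h le_rfl hK⟩
  have hΔc : Continuous ((ofRiemannian h).dalembertian ζ) := continuous_dalembertian _ hζs
  have hζcont : Continuous ζ := hζs.continuous
  have hsuppL : support (fun p ↦ u p * ((ofRiemannian h).dalembertian ζ p - f p * ζ p)) ⊆
      (extChartAt I x).source := by
    intro p hp
    rw [mem_support] at hp
    have hp' : (ofRiemannian h).dalembertian ζ p - f p * ζ p ≠ 0 := right_ne_zero_of_mul hp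
    refine hζsupp (by_contra fun hnot ↦ hp' ?_)
    rw [dalembertian_eq_zero_of_notMem_tsupport _ hnot, image_eq_zero_of_notMem_tsupport hnot,
      mul_zero, sub_zero]
  have hLHS : ∫ p, u p * ((ofRiemannian h).dalembertian ζ p - f p * ζ p) ∂riemannianMeasure h =
      ∫ y in T, u ((extChartAt I x).symm y) *
        ((∑ i, ∑ j, fderiv ℝ (fun z ↦ a i j z * fderiv ℝ ψ z (b i)) y (b j)) -
          (Real.sqrt (Matrix.of (Gh y)).det * f ((extChartAt I x).symm y)) * ψ y) := by
    have hmeas : Measurable (fun p ↦ u p * ((ofRiemannian h).dalembertian ζ p - f p * ζ p)) :=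
      hum.mul (hΔc.sub (hf.mul hζcont)).measurable
    rw [integral_eq_integral_chart h x hmeas hsuppL, ← hTdef]
    refine setIntegral_congr_fun hTm (fun y hy ↦ ?_)
    rw [smul_eq_mul, ← hofG, hζT y hy, ← hdiv y hy, ← hΔ y hy]
    ring
  -- (4) the right-hand side in the chart
  have hsuppR : support (fun p ↦ g p * ζ p) ⊆ (extChartAt I x).source := by
    intro p hp
    rw [mem_support] at hp
    exact hζsupp (subset_tsupport _ (right_ne_zero_of_mul hp))
  have hRHS : ∫ p, g p * ζ p ∂riemannianMeasure h =
      ∫ y in T, (Real.sqrt (Matrix.of (Gh y)).det * g ((extChartAt I x).symm y)) * ψ y := by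
    have hmR : Measurable (fun p ↦ g p * ζ p) := (hg.mul hζcont).measurable
    rw [integral_eq_integral_chart h x hmR hsuppR, ← hTdef]
    refine setIntegral_congr_fun hTm (fun y hy ↦ ?_)
    rw [smul_eq_mul, ← hofG, hζT y hy]
    ring
  -- (5) both target integrands vanish off `tsupport ψ ⊆ T`
  have hvan : ∀ y ∉ T, ∀ i j, fderiv ℝ (fun z ↦ a i j z * fderiv ℝ ψ z (b i)) y (b j) = 0 := by
    intro y hy i j
    have hy' : y ∉ tsupport ψ := fun h' ↦ hy (hψT' h')
    have hev : (fun z ↦ a i j z * fderiv ℝ ψ z (b i)) =ᶠ[𝓝 y] fun _ ↦ 0 := by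
      have h0 : ∀ᶠ z in 𝓝 y, z ∉ tsupport ψ :=
        (isClosed_tsupport ψ).isOpen_compl.mem_nhds hy'
      filter_upwards [h0] with z hz
      have : z ∉ tsupport (fderiv ℝ ψ) := fun h' ↦ hz (tsupport_fderiv_subset ℝ h')
      rw [image_eq_zero_of_notMem_tsupport this, zero_apply, mul_zero]
    rw [hev.fderiv_eq, fderiv_const_apply, zero_apply]
  have hψ0 : ∀ y ∉ T, ψ y = 0 := fun y hy ↦
    image_eq_zero_of_notMem_tsupport fun h' ↦ hy (hψT' h')
  rw [hLHS, hRHS] at hW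
  rw [setIntegral_eq_integral_of_forall_compl_eq_zero (s := T) (fun y hy ↦ by
      simp only [hvan y hy, Finset.sum_const_zero, hψ0 y hy, mul_zero, sub_zero]),
    setIntegral_eq_integral_of_forall_compl_eq_zero (s := T) (fun y hy ↦ by
      rw [hψ0 y hy, mul_zero])] at hW
  rw [ha] at hW
  simpa only [hofG] using hW


end ChartIdentity

/-! ### §2 Local and patched smooth representatives on an open set -/

section Assembly

variable {m : ℕ} {N : Type*} [TopologicalSpace N] [ChartedSpace (EuclideanSpace ℝ (Fin m)) N]
  [IsManifold (𝓡 m) ∞ N] [T2Space N] [LocallyCompactSpace N]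
  [MeasurableSpace N] [BorelSpace N]
  (h : ContMDiffRiemannianMetric (𝓡 m) ∞ (EuclideanSpace ℝ (Fin m)) (TangentSpace (𝓡 m) : N → Type _))
  [(ofRiemannian h).HasLeviCivita]

/-- **Interior regularity, locally, for the equation tested against smooth functions supported
in an open set `U`**: if `u` is measurable and locally integrable, `f, g ∈ C^∞(N)`, and
`∫ u (Δ_h ζ − f ζ) dμ_h = ∫ g ζ dμ_h` for all `ζ ∈ C_c^∞(N)` with `tsupport ζ ⊆ U`, then every
`x ∈ U` has an open neighbourhood `V ⊆ U` on which `u` agrees a.e. with a `C^∞` function.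
[cite: Folland2020, Cor. (6.34)] -/
theorem exists_contMDiffOn_ae_eq_of_veryWeakOn_smooth [Nontrivial (EuclideanSpace ℝ (Fin m))]
    {u : N → ℝ} (hum : Measurable u) (hu : LocallyIntegrable u (riemannianMeasure h))
    {f g : N → ℝ} (hf : ContMDiff (𝓡 m) 𝓘(ℝ, ℝ) ∞ f) (hg : ContMDiff (𝓡 m) 𝓘(ℝ, ℝ) ∞ g)
    {U : Set N} (hUo : IsOpen U)
    (hweak : ∀ ζ : N → ℝ, ContMDiff (𝓡 m) 𝓘(ℝ, ℝ) ∞ ζ → HasCompactSupport ζ → tsupport ζ ⊆ U →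
      ∫ p, u p * ((ofRiemannian h).dalembertian ζ p - f p * ζ p) ∂riemannianMeasure h =
        ∫ p, g p * ζ p ∂riemannianMeasure h) {x : N} (hxU : x ∈ U) :
    ∃ V : Set N, IsOpen V ∧ x ∈ V ∧ V ⊆ U ∧ ∃ w : N → ℝ, ContMDiffOn (𝓡 m) 𝓘(ℝ, ℝ) ∞ w V ∧
      ∀ᵐ p ∂riemannianMeasure h, p ∈ V → u p = w p := by
  classical
  set b : Module.Basis (Fin m) ℝ (EuclideanSpace ℝ (Fin m)) := (EuclideanSpace.basisFun (Fin m) ℝ).toBasis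
    with hb_def
  -- the open subset of the chart target corresponding to `U`
  set T : Set (EuclideanSpace ℝ (Fin m)) :=
    (extChartAt (𝓡 m) x).target ∩ (extChartAt (𝓡 m) x).symm ⁻¹' U with hTdef
  have hT : IsOpen T :=
    (continuousOn_extChartAt_symm x).isOpen_inter_preimage (isOpen_extChartAt_target x) hUo
  have hTt : T ⊆ (extChartAt (𝓡 m) x).target := inter_subset_left
  have hρ := (contDiffOn_sqrt_det_chartGramMatrix h x).mono hTt
  -- the weak identity for zero extensions of tests supported in `T`
  have hWζ : ∀ ψ : EuclideanSpace ℝ (Fin m) → ℝ, ContDiff ℝ ∞ ψ → HasCompactSupport ψ →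
      tsupport ψ ⊆ T →
      ∫ p, u p * ((ofRiemannian h).dalembertian
        ((chartAt (EuclideanSpace ℝ (Fin m)) x).source.indicator (ψ ∘ extChartAt (𝓡 m) x)) p -
          f p * (chartAt (EuclideanSpace ℝ (Fin m)) x).source.indicator (ψ ∘ extChartAt (𝓡 m) x) p)
          ∂riemannianMeasure h =
      ∫ p, g p * (chartAt (EuclideanSpace ℝ (Fin m)) x).source.indicator (ψ ∘ extChartAt (𝓡 m) x) p
        ∂riemannianMeasure h := by
    intro ψ hψ hψc hψT
    have hψT' : tsupport ψ ⊆ (extChartAt (𝓡 m) x).target := hψT.trans hTt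
    refine hweak _ (contMDiff_indicator_comp_extChartAt x hψ hψc hψT')
      (hasCompactSupport_indicator_comp_extChartAt x hψc hψT') ?_
    obtain ⟨hts, -, -⟩ := tsupport_indicator_comp_extChartAt_subset (I := 𝓡 m) x hψc hψT'
    refine hts.trans ?_
    rintro _ ⟨y, hy, rfl⟩
    exact (hψT hy).2
  -- the Euclidean regularity theorem on `T`
  have hxT : extChartAt (𝓡 m) x x ∈ T := by
    refine ⟨(extChartAt (𝓡 m) x).map_source (mem_extChartAt_source x), ?_⟩
    show (extChartAt (𝓡 m) x).symm (extChartAt (𝓡 m) x x) ∈ U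
    rw [(extChartAt (𝓡 m) x).left_inv (mem_extChartAt_source x)]; exact hxU
  obtain ⟨W, hWo, hxW, hWT, w, hw, hae⟩ :=
    Literature.Analysis.Distribution.exists_contDiffOn_ae_eq_of_divForm_weak
      (volume : Measure (EuclideanSpace ℝ (Fin m))) b
      Literature.Analysis.Distribution.Folland1995_cor634_holds hT
      (a := fun i j z ↦ Real.sqrt (chartGramMatrix h x z).det * (chartGramMatrix h x z)⁻¹ j i)
      (fun i j ↦ hρ.mul ((contDiffOn_inv_chartGramMatrix_apply h x j i).mono hTt))
      (fun y hy v hv ↦ divFormCoeff_chart_pos h x hy.1 v hv)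
      (c := fun y ↦ Real.sqrt (chartGramMatrix h x y).det * f ((extChartAt (𝓡 m) x).symm y))
      (hρ.mul ((contDiffOn_comp_extChartAt_symm hf).mono hTt))
      (G := fun y ↦ Real.sqrt (chartGramMatrix h x y).det * g ((extChartAt (𝓡 m) x).symm y))
      (hρ.mul ((contDiffOn_comp_extChartAt_symm hg).mono hTt))
      ((locallyIntegrableOn_comp_extChartAt_symm h x hum hu).mono_set hTt)
      (fun ψ hψ hψc hψT ↦ integral_comp_extChartAt_symm_divForm_of_weakAt h x hum
        hf.continuous hg.continuous hψ hψc (hψT.trans hTt) (hWζ ψ hψ hψc hψT))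
      hxT
  -- pull back
  obtain ⟨V, hV⟩ : ∃ V : Set N, V = (extChartAt (𝓡 m) x).source ∩ extChartAt (𝓡 m) x ⁻¹' W :=
    ⟨_, rfl⟩
  have hVo : IsOpen V := by
    rw [hV]; exact (continuousOn_extChartAt x).isOpen_inter_preimage (isOpen_extChartAt_source x) hWo
  have hxV : x ∈ V := by rw [hV]; exact ⟨mem_extChartAt_source x, hxW⟩
  have hVU : V ⊆ U := by
    rw [hV]
    rintro p ⟨hp1, hp2⟩
    have h1 : (extChartAt (𝓡 m) x).symm (extChartAt (𝓡 m) x p) ∈ U := (hWT hp2).2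
    rwa [(extChartAt (𝓡 m) x).left_inv hp1] at h1
  refine ⟨V, hVo, hxV, hVU, w ∘ extChartAt (𝓡 m) x, ?_, ?_⟩
  · have hwU : ContMDiffOn 𝓘(ℝ, EuclideanSpace ℝ (Fin m)) 𝓘(ℝ, ℝ) ∞ w W :=
      contMDiffOn_iff_contDiffOn.2 hw
    have hφ0 : ContMDiffOn (𝓡 m) 𝓘(ℝ, EuclideanSpace ℝ (Fin m)) ∞ (extChartAt (𝓡 m) x)
        (extChartAt (𝓡 m) x).source := by
      rw [extChartAt_source]
      exact contMDiffOn_extChartAt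
    have hφ : ContMDiffOn (𝓡 m) 𝓘(ℝ, EuclideanSpace ℝ (Fin m)) ∞ (extChartAt (𝓡 m) x) V := by
      rw [hV]
      exact hφ0.mono inter_subset_left
    exact hwU.comp hφ (fun p hp ↦ by rw [hV] at hp; exact hp.2)
  · have := ae_comp_extChartAt_of_ae_target h x (U := W)
      (P := fun y ↦ u ((extChartAt (𝓡 m) x).symm y) = w y) hae
    filter_upwards [this] with p hp hpV
    rw [hV] at hpV
    have h1 := hp hpV.1 hpV.2
    rw [(extChartAt (𝓡 m) x).left_inv hpV.1] at h1
    exact h1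

omit [IsManifold (𝓡 m) ∞ N] [LocallyCompactSpace N] [T2Space N] in
/-- **Patching local smooth representatives on an open set**: if every point of an open set `U`
of a second countable manifold has a neighbourhood in `U` on which `u` agrees a.e. with a `C^∞`
function (for an open-positive measure), then `u` agrees a.e. on `U` with one function `C^∞` on
`U`. [folklore] -/
theorem exists_contMDiffOn_ae_eq_on_of_forall_exists_nhds [SecondCountableTopology N] {μ : Measure N}
    [μ.IsOpenPosMeasure] {u : N → ℝ} {U : Set N}
    (hloc : ∀ x ∈ U, ∃ V : Set N, IsOpen V ∧ x ∈ V ∧ V ⊆ U ∧ ∃ w : N → ℝ,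
      ContMDiffOn (𝓡 m) 𝓘(ℝ, ℝ) ∞ w V ∧ ∀ᵐ p ∂μ, p ∈ V → u p = w p) :
    ∃ v : N → ℝ, ContMDiffOn (𝓡 m) 𝓘(ℝ, ℝ) ∞ v U ∧ ∀ᵐ p ∂μ, p ∈ U → u p = v p := by
  classical
  -- choose data at every point (junk outside `U`)
  have hloc' : ∀ x : N, ∃ V : Set N, IsOpen V ∧ (x ∈ U → x ∈ V) ∧ V ⊆ U ∧ ∃ w : N → ℝ,
      ContMDiffOn (𝓡 m) 𝓘(ℝ, ℝ) ∞ w V ∧ ∀ᵐ p ∂μ, p ∈ V → u p = w p := by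
    intro x
    by_cases hx : x ∈ U
    · obtain ⟨V, hVo, hxV, hVU, w, hw, hae⟩ := hloc x hx
      exact ⟨V, hVo, fun _ ↦ hxV, hVU, w, hw, hae⟩
    · exact ⟨∅, isOpen_empty, fun h' ↦ (hx h').elim, empty_subset _, fun _ ↦ 0,
        contMDiffOn_const, Eventually.of_forall fun p hp ↦ hp.elim⟩
  choose V hVo hxV hVU w hw hae using hloc'
  -- two representatives agree on the overlap of their domains
  have hagree : ∀ x z, EqOn (w x) (w z) (V x ∩ V z) := by
    intro x z
    refine Measure.eqOn_open_of_ae_eq (μ := μ) ?_ ((hVo x).inter (hVo z))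
      ((hw x).continuousOn.mono inter_subset_left) ((hw z).continuousOn.mono inter_subset_right)
    rw [Filter.EventuallyEq, ae_restrict_iff' ((hVo x).inter (hVo z)).measurableSet]
    filter_upwards [hae x, hae z] with p hpx hpz hp
    rw [← hpx hp.1, ← hpz hp.2]
  refine ⟨fun p ↦ w p p, ?_, ?_⟩
  · intro x hx
    have hev : (fun p ↦ w p p) =ᶠ[𝓝 x] w x := by
      filter_upwards [(hVo x).mem_nhds (hxV x hx)] with p hp
      exact hagree p x ⟨hxV p (hVU x hp), hp⟩
    exact (((hw x).contMDiffAt ((hVo x).mem_nhds (hxV x hx))).congr_of_eventuallyEq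
      hev).contMDiffWithinAt
  · obtain ⟨t, htU, htc, ht⟩ := TopologicalSpace.countable_cover_nhdsWithin (s := U) (f := V)
      (fun x hx ↦ mem_nhdsWithin_of_mem_nhds ((hVo x).mem_nhds (hxV x hx)))
    have hall : ∀ᵐ p ∂μ, ∀ x ∈ t, p ∈ V x → u p = w x p :=
      (ae_ball_iff htc).2 fun x _ ↦ hae x
    filter_upwards [hall] with p hp hpU
    obtain ⟨x, hxt, hpx⟩ := mem_iUnion₂.1 (ht hpU)
    rw [hp x hxt hpx]
    exact hagree x p ⟨hpx, hxV p (hVU x hpx)⟩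

/-- **A `C^∞` representative on all of `U`** of a locally integrable weak solution of
`Δ_h u − f u = g` tested against `C_c^∞` functions supported in the open set `U` (second countable
manifold). [cite: Folland2020, Cor. (6.34)] [cite: GilbargTrudinger2001, Cor. 8.11] -/
theorem exists_contMDiffOn_ae_eq_on_of_veryWeakOn_smooth [Nontrivial (EuclideanSpace ℝ (Fin m))]
    [SecondCountableTopology N]
    {u : N → ℝ} (hum : Measurable u) (hu : LocallyIntegrable u (riemannianMeasure h))
    {f g : N → ℝ} (hf : ContMDiff (𝓡 m) 𝓘(ℝ, ℝ) ∞ f) (hg : ContMDiff (𝓡 m) 𝓘(ℝ, ℝ) ∞ g)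
    {U : Set N} (hUo : IsOpen U)
    (hweak : ∀ ζ : N → ℝ, ContMDiff (𝓡 m) 𝓘(ℝ, ℝ) ∞ ζ → HasCompactSupport ζ → tsupport ζ ⊆ U →
      ∫ p, u p * ((ofRiemannian h).dalembertian ζ p - f p * ζ p) ∂riemannianMeasure h =
        ∫ p, g p * ζ p ∂riemannianMeasure h) :
    ∃ v : N → ℝ, ContMDiffOn (𝓡 m) 𝓘(ℝ, ℝ) ∞ v U ∧
      ∀ᵐ p ∂riemannianMeasure h, p ∈ U → u p = v p := by
  haveI : (riemannianMeasure h).IsOpenPosMeasure := isOpenPosMeasure_riemannianMeasure h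
  exact exists_contMDiffOn_ae_eq_on_of_forall_exists_nhds (μ := riemannianMeasure h)
    fun x hx ↦ exists_contMDiffOn_ae_eq_of_veryWeakOn_smooth h hum hu hf hg hUo hweak hx

/-! ### §3 From the weak to the classical equation on `U` -/

omit [MeasurableSpace N] [BorelSpace N] in
/-- **Globalisation near a compact subset**: for `v` smooth on the open set `U` and a compact
`K ⊆ U` there is `V ∈ C_c^∞(N)` equal to `v` on an open set `O ⊇ K` with `closure O ⊆ U`.
[folklore] -/
theorem exists_contMDiff_hasCompactSupport_eqOn_nhds [SigmaCompactSpace N] {v : N → ℝ} {U : Set N}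
    (hUo : IsOpen U) (hv : ContMDiffOn (𝓡 m) 𝓘(ℝ, ℝ) ∞ v U) {K : Set N} (hK : IsCompact K)
    (hKU : K ⊆ U) :
    ∃ (V : N → ℝ) (O : Set N), ContMDiff (𝓡 m) 𝓘(ℝ, ℝ) ∞ V ∧ HasCompactSupport V ∧ IsOpen O ∧
      K ⊆ O ∧ O ⊆ U ∧ EqOn V v O := by
  haveI : RegularSpace N := inferInstance
  obtain ⟨O₂, hO₂o, hKO₂, hO₂U, hO₂c⟩ := exists_open_between_and_isCompact_closure hK hUo hKU
  obtain ⟨O₁, hO₁o, hKO₁, hO₁O₂, hO₁c⟩ := exists_open_between_and_isCompact_closure hK hO₂o hKO₂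
  obtain ⟨η, hη0, hη1, -⟩ := exists_contMDiffMap_zero_one_of_isClosed (I := 𝓡 m) (n := (⊤ : ℕ∞))
    hO₂o.isClosed_compl isClosed_closure (disjoint_compl_left_iff.2 hO₁O₂)
  have hηc : HasCompactSupport (η : N → ℝ) :=
    HasCompactSupport.intro' hO₂c isClosed_closure fun q hq ↦ hη0 fun h' ↦ hq (subset_closure h')
  have hvat : ∀ q ∈ U, ContMDiffAt (𝓡 m) 𝓘(ℝ, ℝ) ∞ v q := fun q hq ↦
    hv.contMDiffAt (hUo.mem_nhds hq)
  refine ⟨fun q ↦ η q * v q, O₁, ?_, hηc.mul_right, hO₁o, hKO₁,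
    (subset_closure.trans hO₁O₂).trans (subset_closure.trans hO₂U), fun q hq ↦ ?_⟩
  · intro q
    by_cases hq : q ∈ closure O₂
    · exact (η.contMDiff q).mul (hvat q (hO₂U hq))
    · have hev : (fun q ↦ η q * v q) =ᶠ[𝓝 q] fun _ ↦ 0 := by
        filter_upwards [isClosed_closure.isOpen_compl.mem_nhds hq] with z hz
        rw [hη0 (fun h' ↦ hz (subset_closure h')), Pi.zero_apply, zero_mul]
      exact contMDiffAt_const.congr_of_eventuallyEq hev
  · show η q * v q = v q
    rw [hη1 (subset_closure hq), Pi.one_apply, one_mul]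

omit [MeasurableSpace N] [BorelSpace N] in
/-- `Δ_h` of a function smooth on an open set `U` is continuous on `U` (locality of `Δ_h` and the
globalisation above). [folklore] -/
theorem continuousOn_dalembertian_of_contMDiffOn [SigmaCompactSpace N] {v : N → ℝ} {U : Set N}
    (hUo : IsOpen U) (hv : ContMDiffOn (𝓡 m) 𝓘(ℝ, ℝ) ∞ v U) :
    ContinuousOn ((ofRiemannian h).dalembertian v) U := by
  intro q hq
  obtain ⟨V, O, hVs, -, hOo, hqO, -, hVO⟩ :=
    exists_contMDiff_hasCompactSupport_eqOn_nhds hUo hv isCompact_singleton (singleton_subset_iff.2 hq)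
  have hqO' : q ∈ O := hqO rfl
  have hV2 : ContMDiff (𝓡 m) 𝓘(ℝ, ℝ) 2 V := by exact_mod_cast contMDiff_infty.1 hVs 2
  have hev : ∀ z ∈ O, (ofRiemannian h).dalembertian v z = (ofRiemannian h).dalembertian V z := by
    intro z hz
    refine (ofRiemannian h).dalembertian_congr_of_eventuallyEq ?_
    filter_upwards [hOo.mem_nhds hz] with y hy using (hVO hy).symm
  have hc : ContinuousAt ((ofRiemannian h).dalembertian V) q := (continuous_dalembertian _ hV2).continuousAt
  refine (hc.congr_of_eventuallyEq ?_).continuousWithinAt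
  filter_upwards [hOo.mem_nhds hqO'] with z hz using hev z hz

/-- **A function smooth on `U` and weakly solving `Δ_h v − f v = g` in `U` solves it classically
on `U`**: for `ζ ∈ C_c^∞` with `tsupport ζ ⊆ U`, a globalisation `V ∈ C_c^∞` of `v` near
`tsupport ζ` has `∫ v (Δζ − fζ) = ∫ V (Δζ − fζ) = ∫ ζ (ΔV − fV) = ∫ ζ (Δv − fv)` (Green's identity
twice, locality of `Δ_h`), so the function `Δ_h v − f v − g`, continuous on `U`, integrates to zero
against every such `ζ` and vanishes on `U` (local fundamental lemma, continuity). [folklore] -/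
theorem dalembertian_sub_mul_eq_on_of_veryWeakOn [SigmaCompactSpace N] {v : N → ℝ} {U : Set N}
    (hUo : IsOpen U) (hv : ContMDiffOn (𝓡 m) 𝓘(ℝ, ℝ) ∞ v U)
    {f g : N → ℝ} (hf : Continuous f) (hg : Continuous g)
    (hweak : ∀ ζ : N → ℝ, ContMDiff (𝓡 m) 𝓘(ℝ, ℝ) ∞ ζ → HasCompactSupport ζ → tsupport ζ ⊆ U →
      ∫ p, v p * ((ofRiemannian h).dalembertian ζ p - f p * ζ p) ∂riemannianMeasure h =
        ∫ p, g p * ζ p ∂riemannianMeasure h) {p : N} (hpU : p ∈ U) :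
    (ofRiemannian h).dalembertian v p - f p * v p = g p := by
  set μ : Measure N := riemannianMeasure h with hμ
  haveI : IsFiniteMeasureOnCompacts μ :=
    ⟨fun K hK ↦ riemannianVolume_lt_top_of_isCompact_holds h le_rfl hK⟩
  haveI : μ.IsOpenPosMeasure := isOpenPosMeasure_riemannianMeasure h
  have hΔv : ContinuousOn ((ofRiemannian h).dalembertian v) U :=
    continuousOn_dalembertian_of_contMDiffOn h hUo hv
  obtain ⟨F, hFdef⟩ : ∃ F : N → ℝ, F = fun q ↦ (ofRiemannian h).dalembertian v q - f q * v q - g q :=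
    ⟨_, rfl⟩
  have hFc : ContinuousOn F U := by
    rw [hFdef]
    exact (hΔv.sub (hf.continuousOn.mul hv.continuousOn)).sub hg.continuousOn
  -- `∫ ζ F dμ = 0` for every smooth `ζ` compactly supported in `U`
  have hzero : ∀ ζ : N → ℝ, ContMDiff (𝓡 m) 𝓘(ℝ, ℝ) ∞ ζ → HasCompactSupport ζ → tsupport ζ ⊆ U →
      ∫ q, ζ q • F q ∂μ = 0 := by
    intro ζ hζ hζc hζU
    have hζ1 : ContMDiff (𝓡 m) 𝓘(ℝ, ℝ) 1 ζ := by exact_mod_cast contMDiff_infty.1 hζ 1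
    have hζ2 : ContMDiff (𝓡 m) 𝓘(ℝ, ℝ) 2 ζ := by exact_mod_cast contMDiff_infty.1 hζ 2
    have hζcont : Continuous ζ := hζ.continuous
    -- globalise `v` near `tsupport ζ`
    obtain ⟨V, O, hVs, hVc, hOo, hKO, hOU, hVO⟩ :=
      exists_contMDiff_hasCompactSupport_eqOn_nhds hUo hv hζc.isCompact hζU
    have hV1 : ContMDiff (𝓡 m) 𝓘(ℝ, ℝ) 1 V := by exact_mod_cast contMDiff_infty.1 hVs 1
    have hV2 : ContMDiff (𝓡 m) 𝓘(ℝ, ℝ) 2 V := by exact_mod_cast contMDiff_infty.1 hVs 2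
    have hΔV : Continuous ((ofRiemannian h).dalembertian V) := continuous_dalembertian _ hV2
    -- `ΔV = Δv` on `O`
    have hΔeq : ∀ z ∈ O, (ofRiemannian h).dalembertian V z = (ofRiemannian h).dalembertian v z := by
      intro z hz
      refine (ofRiemannian h).dalembertian_congr_of_eventuallyEq ?_
      filter_upwards [hOo.mem_nhds hz] with y hy using hVO hy
    -- off `tsupport ζ`, `ζ`, `Δζ` vanish
    have hζ0 : ∀ q ∉ tsupport ζ, ζ q = 0 := fun q hq ↦ image_eq_zero_of_notMem_tsupport hq
    have hΔζ0 : ∀ q ∉ tsupport ζ, (ofRiemannian h).dalembertian ζ q = 0 := fun q hq ↦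
      dalembertian_eq_zero_of_notMem_tsupport _ hq
    -- (a) `∫ v (Δζ - fζ) = ∫ V (Δζ - fζ)`
    have ha : ∫ q, v q * ((ofRiemannian h).dalembertian ζ q - f q * ζ q) ∂μ =
        ∫ q, V q * ((ofRiemannian h).dalembertian ζ q - f q * ζ q) ∂μ := by
      refine integral_congr_ae (Eventually.of_forall fun q ↦ ?_)
      by_cases hq : q ∈ tsupport ζ
      · show v q * _ = V q * _
        rw [hVO (hKO hq)]
      · show v q * _ = V q * _
        rw [hΔζ0 q hq, hζ0 q hq, mul_zero, sub_zero, mul_zero, mul_zero]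
    -- (b) Green twice for the global pair `(V, ζ)`
    have hG1 := integral_mul_dalembertian_eq_neg_integral_innerDual_of_hasCompactSupport_right h hV1
      hζ2 hζc
    have hG2 := integral_mul_dalembertian_eq_neg_integral_innerDual_of_hasCompactSupport h hζ1 hζc
      hV2
    have hsymm : ∫ q, (ofRiemannian h).innerDual q (mvfderiv (𝓡 m) V q).toLinearMap
        (mvfderiv (𝓡 m) ζ q).toLinearMap ∂μ = ∫ q, (ofRiemannian h).innerDual q
        (mvfderiv (𝓡 m) ζ q).toLinearMap (mvfderiv (𝓡 m) V q).toLinearMap ∂μ :=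
      integral_congr_ae (Eventually.of_forall fun q ↦ (ofRiemannian h).innerDual_comm q _ _)
    have hswap : ∫ q, V q * (ofRiemannian h).dalembertian ζ q ∂μ =
        ∫ q, ζ q * (ofRiemannian h).dalembertian V q ∂μ := by
      rw [hG1, hG2, hsymm]
    -- integrability of the pieces
    have hΔζc : Continuous ((ofRiemannian h).dalembertian ζ) := continuous_dalembertian _ hζ2
    have hi1 : Integrable (fun q ↦ V q * (ofRiemannian h).dalembertian ζ q) μ := by
      have hcs : HasCompactSupport (fun q ↦ V q * (ofRiemannian h).dalembertian ζ q) :=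
        HasCompactSupport.intro hζc fun q hq ↦ by rw [hΔζ0 q hq, mul_zero]
      exact (hVs.continuous.mul hΔζc).integrable_of_hasCompactSupport hcs
    have hi2 : Integrable (fun q ↦ V q * (f q * ζ q)) μ := by
      have hcs : HasCompactSupport (fun q ↦ V q * (f q * ζ q)) := (hζc.mul_left).mul_left
      exact (hVs.continuous.mul (hf.mul hζcont)).integrable_of_hasCompactSupport hcs
    have hi3 : Integrable (fun q ↦ ζ q * (ofRiemannian h).dalembertian V q) μ := by
      have hcs : HasCompactSupport (fun q ↦ ζ q * (ofRiemannian h).dalembertian V q) := hζc.mul_right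
      exact (hζcont.mul hΔV).integrable_of_hasCompactSupport hcs
    have hi4 : Integrable (fun q ↦ g q * ζ q) μ :=
      (hg.mul hζcont).integrable_of_hasCompactSupport hζc.mul_left
    have hW := hweak ζ hζ hζc hζU
    rw [ha] at hW
    have hsplit : ∫ q, V q * ((ofRiemannian h).dalembertian ζ q - f q * ζ q) ∂μ =
        ∫ q, V q * (ofRiemannian h).dalembertian ζ q ∂μ - ∫ q, V q * (f q * ζ q) ∂μ := by
      rw [← integral_sub hi1 hi2]
      exact integral_congr_ae (Eventually.of_forall fun q ↦ by ring)
    rw [hsplit, hswap] at hW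
    have hi5 : Integrable (fun q ↦ ζ q * (ofRiemannian h).dalembertian V q - V q * (f q * ζ q)) μ :=
      hi3.sub hi2
    -- `ζ F = ζ ΔV - V f ζ - g ζ` pointwise (`ζ = 0` off `tsupport ζ ⊆ O`, `V = v`, `ΔV = Δv` on `O`)
    have hpt : ∀ q, ζ q • F q = ζ q * (ofRiemannian h).dalembertian V q - V q * (f q * ζ q) - g q * ζ q := by
      intro q
      simp only [hFdef, smul_eq_mul]
      by_cases hq : q ∈ tsupport ζ
      · rw [hΔeq q (hKO hq), hVO (hKO hq)]; ring
      · rw [hζ0 q hq]; ring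
    have hFi : ∫ q, ζ q • F q ∂μ = ∫ q, ζ q * (ofRiemannian h).dalembertian V q ∂μ -
        ∫ q, V q * (f q * ζ q) ∂μ - ∫ q, g q * ζ q ∂μ := by
      rw [← integral_sub hi3 hi2, ← integral_sub hi5 hi4]
      exact integral_congr_ae (Eventually.of_forall fun q ↦ hpt q)
    rw [hFi, hW]
    ring
  -- the local fundamental lemma and continuity on `U`
  have hae := hUo.ae_eq_zero_of_integral_contMDiff_smul_eq_zero (𝓡 m) (μ := μ) (f := F)
    (hFc.locallyIntegrableOn hUo.measurableSet) hzero
  have hF0 : EqOn F (fun _ ↦ 0) U := by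
    refine Measure.eqOn_open_of_ae_eq (μ := μ) ?_ hUo hFc continuousOn_const
    rw [Filter.EventuallyEq, ae_restrict_iff' hUo.measurableSet]
    exact hae
  have := hF0 hpU
  simp only [hFdef] at this
  linarith

/-- **Interior regularity of weakly harmonic functions on an open set** (Weyl's lemma on a
Riemannian manifold, local form): if `u` is measurable, locally integrable and
`∫ u Δ_h ζ dμ_h = 0` for all `ζ ∈ C_c^∞(N)` with `tsupport ζ ⊆ U`, `U` open, then there is `v`,
`C^∞` on `U` with `Δ_h v = 0` on `U` and `u = v` a.e. on `U`.
[cite: Folland2020, Cor. (6.34)] [cite: GilbargTrudinger2001, Cor. 8.11] -/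
theorem exists_contMDiffOn_harmonic_ae_eq_of_weaklyHarmonicOn [Nontrivial (EuclideanSpace ℝ (Fin m))]
    [SecondCountableTopology N]
    {u : N → ℝ} (hum : Measurable u) (hu : LocallyIntegrable u (riemannianMeasure h))
    {U : Set N} (hUo : IsOpen U)
    (hweak : ∀ ζ : N → ℝ, ContMDiff (𝓡 m) 𝓘(ℝ, ℝ) ∞ ζ → HasCompactSupport ζ → tsupport ζ ⊆ U →
      ∫ p, u p * (ofRiemannian h).dalembertian ζ p ∂riemannianMeasure h = 0) :
    ∃ v : N → ℝ, ContMDiffOn (𝓡 m) 𝓘(ℝ, ℝ) ∞ v U ∧ (∀ p ∈ U, (ofRiemannian h).dalembertian v p = 0) ∧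
      ∀ᵐ p ∂riemannianMeasure h, p ∈ U → u p = v p := by
  haveI : SigmaCompactSpace N := by
    haveI := ChartedSpace.locallyCompactSpace (EuclideanSpace ℝ (Fin m)) N
    exact sigmaCompactSpace_of_locallyCompact_secondCountable
  have hweak' : ∀ ζ : N → ℝ, ContMDiff (𝓡 m) 𝓘(ℝ, ℝ) ∞ ζ → HasCompactSupport ζ → tsupport ζ ⊆ U →
      ∫ p, u p * ((ofRiemannian h).dalembertian ζ p - (0 : N → ℝ) p * ζ p) ∂riemannianMeasure h =
        ∫ p, (0 : N → ℝ) p * ζ p ∂riemannianMeasure h := by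
    intro ζ hζ hζc hζU
    simp only [Pi.zero_apply, zero_mul, sub_zero, integral_zero]
    exact hweak ζ hζ hζc hζU
  obtain ⟨v, hv, hae⟩ := exists_contMDiffOn_ae_eq_on_of_veryWeakOn_smooth h hum hu (f := 0) (g := 0)
    contMDiff_const contMDiff_const hUo hweak'
  -- the weak identity passes to `v`
  have hweakv : ∀ ζ : N → ℝ, ContMDiff (𝓡 m) 𝓘(ℝ, ℝ) ∞ ζ → HasCompactSupport ζ → tsupport ζ ⊆ U →
      ∫ p, v p * ((ofRiemannian h).dalembertian ζ p - (0 : N → ℝ) p * ζ p) ∂riemannianMeasure h =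
        ∫ p, (0 : N → ℝ) p * ζ p ∂riemannianMeasure h := by
    intro ζ hζ hζc hζU
    rw [← hweak' ζ hζ hζc hζU]
    refine integral_congr_ae ?_
    filter_upwards [hae] with q hq
    by_cases hqU : q ∈ U
    · rw [hq hqU]
    · have hq' : q ∉ tsupport ζ := fun h' ↦ hqU (hζU h')
      rw [dalembertian_eq_zero_of_notMem_tsupport _ hq', image_eq_zero_of_notMem_tsupport hq']
      simp
  refine ⟨v, hv, fun p hp ↦ ?_, hae⟩
  have key := dalembertian_sub_mul_eq_on_of_veryWeakOn h hUo hv continuous_const continuous_const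
    hweakv hp
  change (ofRiemannian h).dalembertian v p - 0 * v p = 0 at key
  rw [zero_mul, sub_zero] at key
  exact key

end Assembly

end Literature.Geometry.Lorentzian

end
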